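import Literature.Probability.LatticeModels.RandomClusterDomainToBox
import Literature.Probability.LatticeModels.RandomClusterFKG
import HarnessLib

/-!
# The random-cluster measure along an embedding of vertex types: idle vertices do not matter

Topic `Literature/Probability/LatticeModels` (trunk `StatMech`). Let `j : V ↪ U` be an injection of
finite vertex types and let `G'` be a graph on `U` whose edges are exactly the images of the edges
of a graph `G` on `V` (`G'.edgeFinset = G.edgeFinset.map j.sym2Map`), so that the vertices of `U`
off the range of `j` are isolated in `G'`. Then the random-cluster measures of `G` and `G'`
(`rcMeasure`, Grimmett 2006, (1.2)) agree on corresponding events, in the two situations that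
occur when a finite piece of a lattice is viewed inside a larger piece:

* `rcMeasure_real_map_of_wired` — **all idle vertices wired**: if the wired set `W` of `G` is
  nonempty and the wired set `W'` of `G'` consists of `j(W)` together with every vertex off the
  range, the cluster counts agree (`card_connectedComponent_image_eq`,
  `RandomClusterDomainToBox.lean`), hence so do weights, partition functions and measures.
* `rcMeasure_real_map_image` — **idle vertices isolated and unwired** (`W' = j(W)`, e.g. free
  boundary conditions `W = W' = ∅`): the cluster counts differ by the constant number of idle
  vertices (`card_connectedComponent_image_eq_add`), the weights by a constant power of `q`, which
  cancels upon normalisation.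

Events correspond through `ω ↦ j(ω)` (`Finset.map j.sym2Map`); for events of `G'` obtained by
restriction (`Percolation.restrictConfig j`) the correspondence is automatic
(`restrictConfig_coe_map`, `rcMeasure_real_restrictConfig_preimage_of_wired`,
`rcMeasure_real_restrictConfig_preimage_image`). This is the (trivial) part "the measure of the
sub-box seen inside the big box is the measure of the sub-box" of the domain Markov property
(Grimmett 2006, Lemma (4.13); Duminil-Copin–Smirnov 2012, §3.2), which H21's typed vertex sets
make explicit. Everything is proved; no definitions of mathematical content.

## References

* G. Grimmett, *The Random-Cluster Model*, Springer (2006): §1.2 eq. (1.2), §4.2, Lemma (4.13).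
* H. Duminil-Copin, S. Smirnov, *Conformal invariance of lattice models*, Clay Math. Proc. 15
  (2012), §3.2 (domain Markov property).
-/

noncomputable section

open MeasureTheory Finset SimpleGraph

namespace Literature.Probability.LatticeModels

section Embed

variable {V U : Type*} [Fintype V] [DecidableEq V] [Fintype U] [DecidableEq U] (j : V ↪ U)
  {G : SimpleGraph V} [DecidableRel G.Adj] {G' : SimpleGraph U} [DecidableRel G'.Adj]

omit [Fintype V] [DecidableEq V] [Fintype U] [DecidableEq U] in
/-- The mapped edge set, as a set of pairs, is the image under `Sym2.map j`. [folklore] -/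
theorem coe_map_sym2Map (ω : Finset (Sym2 V)) :
    (↑(ω.map j.sym2Map) : Set (Sym2 U)) = Sym2.map j '' ↑ω := by
  rw [Finset.coe_map]
  rfl

omit [Fintype V] [DecidableEq V] [Fintype U] [DecidableEq U] in
/-- Restricting the mapped configuration along `j` gives back the configuration. [folklore] -/
theorem restrictConfig_coe_map (ω : Finset (Sym2 V)) :
    Percolation.restrictConfig j (↑(ω.map j.sym2Map) : Percolation.BondConfig U) =
      (↑ω : Percolation.BondConfig V) := by
  ext e
  rw [Percolation.mem_restrictConfig, coe_map_sym2Map,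
    (Sym2.map.injective j.injective).mem_set_image]

omit [Fintype V] [DecidableEq V] [Fintype U] [DecidableEq U] in
/-- **Cluster counts with the idle vertices wired**: if `W ≠ ∅` and `W'` is `j(W)` together with
all vertices off the range of `j`, then `k^{W'}(j ω) = k^W(ω)`. [cite: Grimmett2006, §4.2] -/
theorem clusterCount_map_of_wired [Finite U] (ω : Finset (Sym2 V)) {W : Set V} (hW : W.Nonempty)
    {W' : Set U} (hW' : ∀ u, u ∈ W' ↔ ∀ x, j x = u → x ∈ W) :
    clusterCount (↑(ω.map j.sym2Map) : Percolation.BondConfig U) W' =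
      clusterCount (↑ω : Percolation.BondConfig V) W := by
  unfold clusterCount
  rw [coe_map_sym2Map]
  exact card_connectedComponent_image_eq j (↑ω) hW hW'

omit [Fintype V] [DecidableEq V] [Fintype U] [DecidableEq U] in
/-- **Cluster counts with the idle vertices isolated**: `k^{j W}(j ω) = k^W(ω) + #(idle vertices)`.
[cite: Grimmett2006, §1.2] -/
theorem clusterCount_map_image [Finite U] (ω : Finset (Sym2 V)) (W : Set V) :
    clusterCount (↑(ω.map j.sym2Map) : Percolation.BondConfig U) (j '' W) =
      clusterCount (↑ω : Percolation.BondConfig V) W + Nat.card {u : U // u ∉ Set.range j} := by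
  unfold clusterCount
  rw [coe_map_sym2Map]
  exact card_connectedComponent_image_eq_add j (↑ω) W

variable (hE : G'.edgeFinset = G.edgeFinset.map j.sym2Map)
include hE

/-- Weights with the idle vertices wired agree. [cite: Grimmett2006, §1.2 eq. (1.2)] -/
theorem rcWeight_map_of_wired (p q : ℝ) (ω : Finset (Sym2 V)) {W : Set V} (hW : W.Nonempty)
    {W' : Set U} (hW' : ∀ u, u ∈ W' ↔ ∀ x, j x = u → x ∈ W) :
    rcWeight G' p q W' (ω.map j.sym2Map) = rcWeight G p q W ω := by
  unfold rcWeight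
  rw [card_map, hE, ← Finset.map_sdiff, card_map, clusterCount_map_of_wired j ω hW hW']

/-- Weights with the idle vertices isolated differ by the constant factor `q^{#idle}`.
[cite: Grimmett2006, §1.2 eq. (1.2)] -/
theorem rcWeight_map_image (p q : ℝ) (ω : Finset (Sym2 V)) (W : Set V) :
    rcWeight G' p q (j '' W) (ω.map j.sym2Map) =
      rcWeight G p q W ω * q ^ Nat.card {u : U // u ∉ Set.range j} := by
  unfold rcWeight
  rw [card_map, hE, ← Finset.map_sdiff, card_map, clusterCount_map_image j ω W, pow_add]
  ring

omit [DecidableEq V] [DecidableEq U] in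
/-- Reindexing sums over configurations: `ω ↦ j(ω)` is a bijection from the edge sets of `G` onto
the edge sets of `G'`. [folklore] -/
theorem sum_powerset_map_embedding {M : Type*} [AddCommMonoid M] (F : Finset (Sym2 U) → M) :
    ∑ ω ∈ G.edgeFinset.powerset, F (ω.map j.sym2Map) = ∑ ω' ∈ G'.edgeFinset.powerset, F ω' := by
  refine Finset.sum_nbij (fun ω => ω.map j.sym2Map) (fun ω hω => ?_)
    (fun ω₁ _ ω₂ _ h => Finset.map_injective _ h) (fun ω' hω' => ?_) (fun _ _ => rfl)
  · rw [Finset.mem_powerset] at hω ⊢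
    rw [hE]
    exact Finset.map_subset_map.2 hω
  · rw [Finset.mem_coe, Finset.mem_powerset, hE, Finset.subset_map_iff] at hω'
    obtain ⟨ω, hω, rfl⟩ := hω'
    exact ⟨ω, by rw [Finset.mem_coe, Finset.mem_powerset]; exact hω, rfl⟩

/-- Partition functions with the idle vertices wired agree. [cite: Grimmett2006, §1.2 eq. (1.3)] -/
theorem rcPartitionFunction_map_of_wired (p q : ℝ) {W : Set V} (hW : W.Nonempty)
    {W' : Set U} (hW' : ∀ u, u ∈ W' ↔ ∀ x, j x = u → x ∈ W) :
    rcPartitionFunction G' p q W' = rcPartitionFunction G p q W := by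
  unfold rcPartitionFunction
  rw [← sum_powerset_map_embedding j hE]
  exact Finset.sum_congr rfl fun ω _ => rcWeight_map_of_wired j hE p q ω hW hW'

/-- Partition functions with the idle vertices isolated differ by `q^{#idle}`.
[cite: Grimmett2006, §1.2 eq. (1.3)] -/
theorem rcPartitionFunction_map_image (p q : ℝ) (W : Set V) :
    rcPartitionFunction G' p q (j '' W) =
      rcPartitionFunction G p q W * q ^ Nat.card {u : U // u ∉ Set.range j} := by
  unfold rcPartitionFunction
  rw [← sum_powerset_map_embedding j hE, Finset.sum_mul]
  exact Finset.sum_congr rfl fun ω _ => rcWeight_map_image j hE p q ω W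

/-- **The random-cluster measure seen along an embedding, idle vertices wired** (Grimmett 2006,
Lemma (4.13), the identification of the sub-box measure): if `G'` has exactly the images of the
edges of `G`, `W ≠ ∅`, and `W'` is `j(W)` together with all vertices of `U` off the range of `j`,
then `φ^{W'}_{G',p,q}(A') = φ^W_{G,p,q}(A)` whenever `A'` and `A` correspond under `ω ↦ j(ω)` on
the edge sets of `G`. [cite: Grimmett2006, Lemma (4.13)] -/
theorem rcMeasure_real_map_of_wired {p q : ℝ} (hp : p ∈ Set.Icc (0 : ℝ) 1) (hq : 0 < q)
    {W : Set V} (hW : W.Nonempty) {W' : Set U} (hW' : ∀ u, u ∈ W' ↔ ∀ x, j x = u → x ∈ W)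
    {A : Set (Percolation.BondConfig V)} {A' : Set (Percolation.BondConfig U)}
    (hAA' : ∀ ω : Finset (Sym2 V), ω ⊆ G.edgeFinset →
      ((↑ω : Percolation.BondConfig V) ∈ A ↔ (↑(ω.map j.sym2Map) : Percolation.BondConfig U) ∈ A')) :
    (rcMeasure G' p q W').real A' = (rcMeasure G p q W).real A := by
  classical
  rw [rcMeasure_real_apply G hp hq W A, rcMeasure_real_apply G' hp hq W' A',
    ← sum_powerset_map_embedding j hE, rcPartitionFunction_map_of_wired j hE p q hW hW']
  refine Finset.sum_congr rfl fun ω hω => ?_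
  rw [rcWeight_map_of_wired j hE p q ω hW hW', ← hAA' ω (Finset.mem_powerset.1 hω)]

/-- **The random-cluster measure seen along an embedding, idle vertices isolated** (in particular
free boundary conditions, `W = ∅`): `φ^{j W}_{G',p,q}(A') = φ^W_{G,p,q}(A)` for corresponding events
(the constant factor `q^{#idle}` of the weights cancels). [cite: Grimmett2006, §1.2 and Lemma (4.13)] -/
theorem rcMeasure_real_map_image {p q : ℝ} (hp : p ∈ Set.Icc (0 : ℝ) 1) (hq : 0 < q) (W : Set V)
    {A : Set (Percolation.BondConfig V)} {A' : Set (Percolation.BondConfig U)}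
    (hAA' : ∀ ω : Finset (Sym2 V), ω ⊆ G.edgeFinset →
      ((↑ω : Percolation.BondConfig V) ∈ A ↔ (↑(ω.map j.sym2Map) : Percolation.BondConfig U) ∈ A')) :
    (rcMeasure G' p q (j '' W)).real A' = (rcMeasure G p q W).real A := by
  classical
  have hc : q ^ Nat.card {u : U // u ∉ Set.range j} ≠ 0 := pow_ne_zero _ hq.ne'
  rw [rcMeasure_real_apply G hp hq W A, rcMeasure_real_apply G' hp hq (j '' W) A',
    ← sum_powerset_map_embedding j hE, rcPartitionFunction_map_image j hE p q W]
  refine Finset.sum_congr rfl fun ω hω => ?_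
  rw [rcWeight_map_image j hE p q ω W, ← hAA' ω (Finset.mem_powerset.1 hω),
    mul_div_mul_right _ _ hc]

/-- The wired identification for events read through the restriction along `j`:
`φ^{W'}_{G'}(ρ⁻¹ A) = φ^W_G(A)`, `ρ = restrictConfig j`. [cite: Grimmett2006, Lemma (4.13)] -/
theorem rcMeasure_real_restrictConfig_preimage_of_wired {p q : ℝ} (hp : p ∈ Set.Icc (0 : ℝ) 1)
    (hq : 0 < q) {W : Set V} (hW : W.Nonempty) {W' : Set U}
    (hW' : ∀ u, u ∈ W' ↔ ∀ x, j x = u → x ∈ W) (A : Set (Percolation.BondConfig V)) :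
    (rcMeasure G' p q W').real (Percolation.restrictConfig j ⁻¹' A) = (rcMeasure G p q W).real A :=
  rcMeasure_real_map_of_wired j hE hp hq hW hW' fun ω _ => by
    rw [Set.mem_preimage, restrictConfig_coe_map]

/-- The isolated identification for events read through the restriction along `j`:
`φ^{j W}_{G'}(ρ⁻¹ A) = φ^W_G(A)`. [cite: Grimmett2006, Lemma (4.13)] -/
theorem rcMeasure_real_restrictConfig_preimage_image {p q : ℝ} (hp : p ∈ Set.Icc (0 : ℝ) 1)
    (hq : 0 < q) (W : Set V) (A : Set (Percolation.BondConfig V)) :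
    (rcMeasure G' p q (j '' W)).real (Percolation.restrictConfig j ⁻¹' A) =
      (rcMeasure G p q W).real A :=
  rcMeasure_real_map_image j hE hp hq W fun ω _ => by
    rw [Set.mem_preimage, restrictConfig_coe_map]

end Embed

end Literature.Probability.LatticeModels
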